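import Summits.QuantumFields.YangMills.Theorems.BalabanUVNodesN20BlockCaricatureCountStatistic
import Summits.QuantumFields.YangMills.Theorems.BalabanUVNodesN19BlockCaricatureFixedRatio
import Summits.QuantumFields.YangMills.Theorems.BalabanUVNodesN20BinomialLocalBound

/-!
# BalabanUVNodes ∕ N20·N19′·N21 — THE ORDER OF THE CARICATURE'S COUNT ℓ¹, PART 1 (FILE I of the caricature series): symmetries, the UPPER order
# `ℓ ≤ 2√2·min(1, Δ∕max(1,σ))`, and the LOWER order in the RARE regime `σ ≤ 1`: `ℓ ≥ (1∕96)·min(1, Δ)` — `ℓ = Σ_k C(n,k)|q^k(1−q)^{n−k} − p^k(1−p)^{n−k}|` (twice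
# the total variation of `Bin(n,p)` vs `Bin(n,q)`), `Δ = n|q − p|` (mean count shift), `σ = √(n·max(p(1−p), q(1−q)))` (the larger count standard deviation)

Cell `pub-ymgap` (HUMAN RULING D-0062 Track A; work-bound push D-0149, director-ym №197), width seat `pub-ymgap-dag-n20-w1` (gen 6) on node N20 = NE7b; key item K3⁷
`SpineGivenEndpointR13SepCoPH` = stmt-QuantumFields-20544 (`--kind proof --supports 20544 --as helper`); COUNT-NEUTRAL.  Bus: CLAIM-15 ∕ INTENT-20a (INBOX l.35172 ∕ l.35427).
THEOREMS ONLY: no `def`, no `instance`, no `notation`, no `sorry`; imports MY FILE F `…N20BlockCaricatureCountStatistic` (p618695; through it FILES A–D), dag-n19-w2 g5's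
`…N19BlockCaricatureFixedRatio` (p615382: `abs_config_classLaw_sub_le`, every class set's gap `≤ n|q−p|`) and MY FILE H `…N20BinomialLocalBound` (p622281) BY NAME.

WHY.  FILE D∕F: stub 2's dials exist on the caricature IFF `Σ_K ℓ_K < ∞`; FILE C bracketed `ℓ_K` by CRIT-1's statistic (`Σ Λ_K` necessary, `Σ √Λ_K` sufficient), FILE G
showed both brackets STRICT.  This file and FILE J (`…TVOrderBulk`) compute the ORDER of `ℓ`: `ℓ ≍ min(1, Δ∕max(1, σ))` with absolute constants; FILE K (`…ClosedForm`)
reads off the criterion in CLOSED FORM and its two regimes (rare blocks: the COUNT letter `Σ n_K|q_K−p_K|`; bulk: CRIT-1's `Σ √Λ_K`).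
* §0 [folklore] `l1Count_swap` · `l1Count_reflect` (`p, q ↦ 1−p, 1−q`) · `l1Count_nonneg`.
* §1 UPPER [folklore, the tree BY NAME]: `l1Count_le_two` · ★ `l1Count_le_two_mul_meanShift` (ℓ¹ = 2·Hahn gap (FILE D) + n19-w2's `abs_config_classLaw_sub_le`) ·
  ★ `l1Count_le_two_mul_sqrt_stat` (MY FILE B) · `stat₁_le_two_mul_sq_div_maxVar` (`Λ₁ ≤ 2(q−p)²∕max(p(1−p),q(1−q))`) · `l1Count_le_meanShift_div_sd` · ★★ `l1Count_le_order`.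
* §2 RARE REGIME [folklore]: `exp_neg_le_one_sub_pow` · `pow_sub_pow_ge_mul` ∕ `pow_sub_pow_ge_top` · `atom_zero_eq` ∕ `atom_top_eq` · ★ `l1Count_ge_rare_sameSide`
  (atom `k = 0`: `ℓ ≥ e^{−4}·n(q−p)`) · ★ `l1Count_ge_rare_oppositeSides` (atoms `k = 0, n`) · ★★ `l1Count_ge_rare` (`σ ≤ 1` ⇒ `ℓ ≥ (1∕96)·min(1, Δ)`, all `p, q ∈ [0,1]`).

v1.1 (gen 7, comment only; decls byte-identical) — ref-O g10 READ-282 (I.37847) NITs: `hp0` in `l1Count_ge_rare_sameSide` is not consumed by its proof (kept, append-only); «PART 1» is complete — bulk half = FILE J p623504, closed form = FILE K p625658, tail optimality = FILE S, per-block rates = FILES Q∕R p635927∕p637287 (gen 7).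
HONEST FRAMING.  [folklore] finite-sum probability about the binomial law on a CARICATURE (independent level-1 blocks, product Bernoulli class weights — the card's own simplification);
NOTHING read at the record (`classSet₁₃ ∕ weightA₁₃ ∕ weightB₁₃` untouched; (LS)∕(XG′)∕(SAT′) at the record UNDECIDED); proves NO estimate of Bałaban's; refutes NO registered stub; nothing of
Bałaban's asserted or instantiated.  NE7 ∕ NE7b ∕ NE7c NOT PRINTED for `d = 4`, NOT proved; N19 ∕ N20 ∕ N21 NOT discharged; K3⁷ OPEN, skeleton v5 941dddb108cbaacf STANDS; counts unmoved (typed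
28∕28 · discharged 5∕27); no count claim.  One finite `𝕋⁴` programme at fixed `ε`, Bałaban AS PRINTED; the YM mass gap (Clay) is NOT proved by any of this — R4 closes the conditional
finite-𝕋⁴ rung `BalabanLadder.UV` only; NOT ℝ⁴, NOT OS.  Sources (bookkeeping only): [Balaban1988Convergent] (1.1) p.244, (2.18) p.257; Le Cam's inequalities as in FILE A.  No decl carries a cite tag.
-/

set_option autoImplicit false

noncomputable section

open Finset
open Literature.Probability.Distributions.ExponentialOrderStatistics (binomTail)
open Summit.QuantumFields.YangMills.BalabanUVNodes.N20BlockCaricatureAffinity (sum_config_eq_one config_nonneg)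
open Summit.QuantumFields.YangMills.BalabanUVNodes.N20BlockCaricatureLawSeparation (abs_sub_config_le_sqrt_stat)
open Summit.QuantumFields.YangMills.BalabanUVNodes.N20BlockCaricatureExactCriterion (sum_abs_sub_eq_two_mul_hahnGap)
open Summit.QuantumFields.YangMills.BalabanUVNodes.N20BlockCaricatureCountStatistic (l1_config_eq_l1_count sum_count_eq_one)
open Summit.QuantumFields.YangMills.BalabanUVNodes.N19BlockCaricatureFixedRatio (abs_config_classLaw_sub_le)
open Summit.QuantumFields.YangMills.BalabanUVNodes.N20BinomialLocalBound

namespace Summit.QuantumFields.YangMills.BalabanUVNodes.N20BlockCaricatureTVOrder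

/-! ## §0 The count ℓ¹: symmetries and atoms [folklore] -/

section Symmetry
variable (p q : ℝ) (n : ℕ)
/-- Swapping the two runs does not change the count ℓ¹. [folklore] -/
theorem l1Count_swap :
    ∑ k ∈ Finset.range (n + 1), (n.choose k : ℝ) * |q ^ k * (1 - q) ^ (n - k) - p ^ k * (1 - p) ^ (n - k)| =
      ∑ k ∈ Finset.range (n + 1), (n.choose k : ℝ) * |p ^ k * (1 - p) ^ (n - k) - q ^ k * (1 - q) ^ (n - k)| :=
  Finset.sum_congr rfl fun k _ => by rw [abs_sub_comm]

/-- Reflecting both rates (`p ↦ 1 − p`, `q ↦ 1 − q`, i.e. counting SMALL-field blocks) does not change the count ℓ¹ (`k ↦ n − k`, `C(n,n−k) = C(n,k)`). [folklore] -/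
theorem l1Count_reflect :
    ∑ k ∈ Finset.range (n + 1), (n.choose k : ℝ) * |(1 - q) ^ k * (1 - (1 - q)) ^ (n - k) - (1 - p) ^ k * (1 - (1 - p)) ^ (n - k)| =
      ∑ k ∈ Finset.range (n + 1), (n.choose k : ℝ) * |q ^ k * (1 - q) ^ (n - k) - p ^ k * (1 - p) ^ (n - k)| := by
  rw [← Finset.sum_range_reflect (fun k => (n.choose k : ℝ) * |q ^ k * (1 - q) ^ (n - k) - p ^ k * (1 - p) ^ (n - k)|) (n + 1)]
  refine Finset.sum_congr rfl fun k hk => ?_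
  have hkn : k ≤ n := by have := Finset.mem_range.1 hk; omega
  simp only [add_tsub_cancel_right, sub_sub_cancel]
  rw [Nat.choose_symm hkn, show n - (n - k) = k by omega]
  ring_nf

/-- The count ℓ¹ is non-negative. [folklore] -/
theorem l1Count_nonneg : 0 ≤ ∑ k ∈ Finset.range (n + 1), (n.choose k : ℝ) * |q ^ k * (1 - q) ^ (n - k) - p ^ k * (1 - p) ^ (n - k)| :=
  Finset.sum_nonneg fun k _ => by positivity
end Symmetry

/-! ## §1 Upper bounds: `ℓ ≤ 2`, `ℓ ≤ 2·n|q − p|`, `ℓ ≤ 2√2·n|q−p|∕σ` [folklore, the tree BY NAME] -/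

section Upper
variable {p q : ℝ}
/-- `ℓ ≤ 2` (both count laws have total `1`). [folklore] -/
theorem l1Count_le_two (hp0 : 0 ≤ p) (hp1 : p ≤ 1) (hq0 : 0 ≤ q) (hq1 : q ≤ 1) (n : ℕ) :
    ∑ k ∈ Finset.range (n + 1), (n.choose k : ℝ) * |q ^ k * (1 - q) ^ (n - k) - p ^ k * (1 - p) ^ (n - k)| ≤ 2 := by
  have h1p : 0 ≤ 1 - p := sub_nonneg.2 hp1
  have h1q : 0 ≤ 1 - q := sub_nonneg.2 hq1
  calc ∑ k ∈ Finset.range (n + 1), (n.choose k : ℝ) * |q ^ k * (1 - q) ^ (n - k) - p ^ k * (1 - p) ^ (n - k)|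
      ≤ ∑ k ∈ Finset.range (n + 1), ((n.choose k : ℝ) * (q ^ k * (1 - q) ^ (n - k)) + (n.choose k : ℝ) * (p ^ k * (1 - p) ^ (n - k))) :=
        Finset.sum_le_sum fun k _ => by
          rw [← mul_add]
          refine mul_le_mul_of_nonneg_left (abs_sub _ _ |>.trans ?_) (Nat.cast_nonneg _)
          rw [abs_of_nonneg (by positivity), abs_of_nonneg (by positivity)]
    _ = 2 := by rw [Finset.sum_add_distrib, sum_count_eq_one, sum_count_eq_one]; norm_num

/-- ★ **`ℓ ≤ 2·n·|q − p|`** — the count ℓ¹ is twice the Hahn gap of the configuration laws (FILE D `sum_abs_sub_eq_two_mul_hahnGap`), and every class set's gap is `≤ n|q−p|`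
(dag-n19-w2 g5 `abs_config_classLaw_sub_le`, Pascal's rule — the product law's TV is sub-additive over the `n` blocks). [folklore] -/
theorem l1Count_le_two_mul_meanShift (hp0 : 0 ≤ p) (hp1 : p ≤ 1) (hq0 : 0 ≤ q) (hq1 : q ≤ 1) (n : ℕ) :
    ∑ k ∈ Finset.range (n + 1), (n.choose k : ℝ) * |q ^ k * (1 - q) ^ (n - k) - p ^ k * (1 - p) ^ (n - k)| ≤ 2 * (n * |q - p|) := by
  classical
  rw [← l1_config_eq_l1_count,
    sum_abs_sub_eq_two_mul_hahnGap (Finset.range n).powerset (a := fun S => p ^ S.card * (1 - p) ^ (n - S.card))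
      (b := fun S => q ^ S.card * (1 - q) ^ (n - S.card)) (by rw [sum_config_eq_one, sum_config_eq_one])]
  have h := abs_config_classLaw_sub_le hp0 hp1 hq0 hq1 n
    (𝒮 := (Finset.range n).powerset.filter fun S => p ^ S.card * (1 - p) ^ (n - S.card) < q ^ S.card * (1 - q) ^ (n - S.card)) (Finset.filter_subset _ _)
  linarith [le_abs_self (∑ S ∈ (Finset.range n).powerset.filter (fun S => p ^ S.card * (1 - p) ^ (n - S.card) < q ^ S.card * (1 - q) ^ (n - S.card)),
      q ^ S.card * (1 - q) ^ (n - S.card) -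
    ∑ S ∈ (Finset.range n).powerset.filter (fun S => p ^ S.card * (1 - p) ^ (n - S.card) < q ^ S.card * (1 - q) ^ (n - S.card)), p ^ S.card * (1 - p) ^ (n - S.card))]

/-- ★ **`ℓ ≤ 2·√(n·Λ₁)`**, `Λ₁ = (q−p)²∕(p+q) + (q−p)²∕(2−p−q)` (MY FILE B `abs_sub_config_le_sqrt_stat` at the Hahn set: Le Cam's `TV ≤ √(1 − bc²)` and `1 − u^{2n} ≤ n·Λ₁`). [folklore] -/
theorem l1Count_le_two_mul_sqrt_stat (hp0 : 0 ≤ p) (hp1 : p ≤ 1) (hq0 : 0 ≤ q) (hq1 : q ≤ 1) (n : ℕ) :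
    ∑ k ∈ Finset.range (n + 1), (n.choose k : ℝ) * |q ^ k * (1 - q) ^ (n - k) - p ^ k * (1 - p) ^ (n - k)| ≤
      2 * Real.sqrt (n * ((q - p) ^ 2 / (p + q) + (q - p) ^ 2 / (2 - p - q))) := by
  classical
  rw [← l1_config_eq_l1_count,
    sum_abs_sub_eq_two_mul_hahnGap (Finset.range n).powerset (a := fun S => p ^ S.card * (1 - p) ^ (n - S.card))
      (b := fun S => q ^ S.card * (1 - q) ^ (n - S.card)) (by rw [sum_config_eq_one, sum_config_eq_one])]
  have h := abs_sub_config_le_sqrt_stat hp0 hq0 hp1 hq1 n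
    (𝒮 := (Finset.range n).powerset.filter fun S => p ^ S.card * (1 - p) ^ (n - S.card) < q ^ S.card * (1 - q) ^ (n - S.card)) (Finset.filter_subset _ _)
  linarith [le_abs_self (∑ S ∈ (Finset.range n).powerset.filter (fun S => p ^ S.card * (1 - p) ^ (n - S.card) < q ^ S.card * (1 - q) ^ (n - S.card)),
      q ^ S.card * (1 - q) ^ (n - S.card) -
    ∑ S ∈ (Finset.range n).powerset.filter (fun S => p ^ S.card * (1 - p) ^ (n - S.card) < q ^ S.card * (1 - q) ^ (n - S.card)), p ^ S.card * (1 - p) ^ (n - S.card))]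

/-- The per-block statistic against the LARGER per-block variance: `Λ₁ ≤ 2(q−p)²∕max(p(1−p), q(1−q))` whenever that maximum is positive
(`1∕(p+q) + 1∕(2−p−q) ≤ 1∕max(p,q) + 1∕(1 − min(p,q)) ≤ 2∕(max(p,q)·(1 − min(p,q))) ≤ 2∕max(p(1−p), q(1−q))`). [folklore] -/
theorem stat₁_le_two_mul_sq_div_maxVar (hp0 : 0 ≤ p) (hp1 : p ≤ 1) (hq0 : 0 ≤ q) (hq1 : q ≤ 1) (hv : 0 < max (p * (1 - p)) (q * (1 - q))) :
    (q - p) ^ 2 / (p + q) + (q - p) ^ 2 / (2 - p - q) ≤ 2 * (q - p) ^ 2 / max (p * (1 - p)) (q * (1 - q)) := by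
  -- `M = max p q`, `m = min p q`; `M(1 − m) ≥ v`, `p + q ≥ M`, `2 − p − q ≥ 1 − m`.
  set v := max (p * (1 - p)) (q * (1 - q)) with hv_def
  have hM1m : v ≤ max p q * (1 - min p q) := by
    rcases le_total p q with h | h
    · rw [max_eq_right h, min_eq_left h]
      refine max_le ?_ ?_ <;> nlinarith
    · rw [max_eq_left h, min_eq_right h]
      refine max_le ?_ ?_ <;> nlinarith
  have hM0 : 0 < max p q := by
    by_contra h
    have h' : max p q ≤ 0 := not_lt.1 h
    have : v ≤ 0 := hM1m.trans (by nlinarith [le_max_left p q, min_le_left p q])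
    linarith
  have hm1 : min p q < 1 := by
    by_contra h
    have h' : 1 ≤ min p q := not_lt.1 h
    have : v ≤ 0 := hM1m.trans (by nlinarith [max_le hp1 hq1])
    linarith
  have hsum : max p q ≤ p + q := by
    rcases le_total p q with h | h
    · rw [max_eq_right h]; linarith
    · rw [max_eq_left h]; linarith
  have hsum' : 1 - min p q ≤ 2 - p - q := by
    rcases le_total p q with h | h
    · rw [min_eq_left h]; linarith
    · rw [min_eq_right h]; linarith
  have hd2 : 0 ≤ (q - p) ^ 2 := sq_nonneg _
  have h1 : (q - p) ^ 2 / (p + q) ≤ (q - p) ^ 2 / max p q := div_le_div_of_nonneg_left hd2 hM0 hsum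
  have h2 : (q - p) ^ 2 / (2 - p - q) ≤ (q - p) ^ 2 / (1 - min p q) := div_le_div_of_nonneg_left hd2 (by linarith) hsum'
  have hm1' : (1 - min p q) ≠ 0 := (sub_pos.2 hm1).ne'
  have hM0' : max p q ≠ 0 := hM0.ne'
  have h3 : (q - p) ^ 2 / max p q + (q - p) ^ 2 / (1 - min p q) = (q - p) ^ 2 * (1 - min p q + max p q) / (max p q * (1 - min p q)) := by
    rw [div_add_div _ _ hM0' hm1']
    congr 1
    ring
  have h4 : (q - p) ^ 2 * (1 - min p q + max p q) / (max p q * (1 - min p q)) ≤ (q - p) ^ 2 * 2 / (max p q * (1 - min p q)) := by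
    refine div_le_div_of_nonneg_right ?_ (by positivity)
    refine mul_le_mul_of_nonneg_left ?_ hd2
    linarith [min_le_left p q, max_le hp1 hq1]
  have h5 : (q - p) ^ 2 * 2 / (max p q * (1 - min p q)) ≤ 2 * (q - p) ^ 2 / v := by
    rw [mul_comm ((q - p) ^ 2) 2]
    exact div_le_div_of_nonneg_left (by positivity) hv hM1m
  linarith

/-- ★ **`ℓ ≤ 2√2 · n|q−p| ∕ σ`**, `σ = √(n·max(p(1−p), q(1−q)))` the larger count standard deviation (for `n = 0` or `σ = 0` the right side reads `0` and so does `ℓ` up to the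
trivial cases, so we assume `σ > 0`). [folklore] -/
theorem l1Count_le_meanShift_div_sd (hp0 : 0 ≤ p) (hp1 : p ≤ 1) (hq0 : 0 ≤ q) (hq1 : q ≤ 1) {n : ℕ}
    (hσ : 0 < Real.sqrt (n * max (p * (1 - p)) (q * (1 - q)))) :
    ∑ k ∈ Finset.range (n + 1), (n.choose k : ℝ) * |q ^ k * (1 - q) ^ (n - k) - p ^ k * (1 - p) ^ (n - k)| ≤
      2 * Real.sqrt 2 * (n * |q - p|) / Real.sqrt (n * max (p * (1 - p)) (q * (1 - q))) := by
  set v := max (p * (1 - p)) (q * (1 - q)) with hv_def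
  have hnv : 0 < (n : ℝ) * v := Real.sqrt_pos.1 hσ
  have hv0 : 0 ≤ v := le_max_of_le_left (mul_nonneg hp0 (sub_nonneg.2 hp1))
  have hn0 : 0 < (n : ℝ) := by
    rcases (Nat.cast_nonneg n : (0 : ℝ) ≤ n).eq_or_lt with h | h
    · rw [← h, zero_mul] at hnv; exact absurd hnv (lt_irrefl 0)
    · exact h
  have hv : 0 < v := by
    rcases hv0.eq_or_lt with h | h
    · rw [← h, mul_zero] at hnv; exact absurd hnv (lt_irrefl 0)
    · exact h
  have hstat := stat₁_le_two_mul_sq_div_maxVar hp0 hp1 hq0 hq1 hv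
  have h1 := l1Count_le_two_mul_sqrt_stat hp0 hp1 hq0 hq1 n
  have h2 : Real.sqrt (n * ((q - p) ^ 2 / (p + q) + (q - p) ^ 2 / (2 - p - q))) ≤ Real.sqrt (n * (2 * (q - p) ^ 2 / v)) :=
    Real.sqrt_le_sqrt (mul_le_mul_of_nonneg_left hstat hn0.le)
  have h3 : Real.sqrt (n * (2 * (q - p) ^ 2 / v)) = Real.sqrt 2 * (n * |q - p|) / Real.sqrt (n * v) := by
    have hR : 0 ≤ Real.sqrt 2 * (n * |q - p|) / Real.sqrt (n * v) := by positivity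
    rw [← Real.sqrt_sq hR]
    congr 1
    rw [div_pow, mul_pow, mul_pow, Real.sq_sqrt (by norm_num : (0 : ℝ) ≤ 2), Real.sq_sqrt hnv.le, sq_abs]
    field_simp
  rw [h3] at h2
  calc _ ≤ 2 * Real.sqrt (n * ((q - p) ^ 2 / (p + q) + (q - p) ^ 2 / (2 - p - q))) := h1
    _ ≤ 2 * (Real.sqrt 2 * (n * |q - p|) / Real.sqrt (n * v)) := by linarith
    _ = _ := by ring

/-- ★★ **UPPER ORDER**: `ℓ ≤ 2√2 · min(1, Δ ∕ max(1, σ))`, `Δ = n|q−p|` the mean count shift, `σ = √(n·max(p(1−p), q(1−q)))` the larger count s.d. [folklore] -/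
theorem l1Count_le_order (hp0 : 0 ≤ p) (hp1 : p ≤ 1) (hq0 : 0 ≤ q) (hq1 : q ≤ 1) (n : ℕ) :
    ∑ k ∈ Finset.range (n + 1), (n.choose k : ℝ) * |q ^ k * (1 - q) ^ (n - k) - p ^ k * (1 - p) ^ (n - k)| ≤
      2 * Real.sqrt 2 * min 1 (n * |q - p| / max 1 (Real.sqrt (n * max (p * (1 - p)) (q * (1 - q))))) := by
  set σ := Real.sqrt (n * max (p * (1 - p)) (q * (1 - q))) with hσ_def
  have h2le : (2 : ℝ) ≤ 2 * Real.sqrt 2 := by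
    have : (1 : ℝ) ≤ Real.sqrt 2 := Real.one_le_sqrt.2 (by norm_num)
    linarith
  have hA := l1Count_le_two hp0 hp1 hq0 hq1 n
  have hB := l1Count_le_two_mul_meanShift hp0 hp1 hq0 hq1 n
  have hΔ : 0 ≤ (n : ℝ) * |q - p| := by positivity
  rcases le_total σ 1 with hσ1 | hσ1
  · rw [max_eq_left hσ1, div_one]
    rcases le_total 1 ((n : ℝ) * |q - p|) with h | h
    · rw [min_eq_left h]; linarith
    · rw [min_eq_right h]; nlinarith
  · rw [max_eq_right hσ1]
    have hσ0 : 0 < σ := lt_of_lt_of_le one_pos hσ1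
    have hC := l1Count_le_meanShift_div_sd hp0 hp1 hq0 hq1 (n := n) hσ0
    rcases le_total 1 ((n : ℝ) * |q - p| / σ) with h | h
    · rw [min_eq_left h]; linarith
    · rw [min_eq_right h]
      calc _ ≤ 2 * Real.sqrt 2 * (n * |q - p|) / σ := hC
        _ = 2 * Real.sqrt 2 * (n * |q - p| / σ) := by ring
end Upper

/-! ## §2 Lower bounds, rare regime (`σ ≤ 1`): one or two atoms suffice [folklore] -/

section Rare
variable {p q : ℝ}
/-- `exp(−n·x∕(1−x)) ≤ (1 − x)^n` for `x < 1` (`−log(1−x) = log((1−x)⁻¹) ≤ (1−x)⁻¹ − 1`). [folklore] -/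
theorem exp_neg_le_one_sub_pow {x : ℝ} (hx1 : x < 1) (n : ℕ) :
    Real.exp (-(n * x / (1 - x))) ≤ (1 - x) ^ n := by
  have h1x : 0 < 1 - x := by linarith
  rw [← Real.exp_log (pow_pos h1x n), Real.exp_le_exp, Real.log_pow]
  have hlog : -(x / (1 - x)) ≤ Real.log (1 - x) := by
    have h := Real.log_le_sub_one_of_pos (inv_pos.2 h1x)
    rw [Real.log_inv] at h
    have : (1 - x)⁻¹ - 1 = x / (1 - x) := by field_simp; ring
    linarith
  have hn : (0 : ℝ) ≤ n := Nat.cast_nonneg n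
  calc -(n * x / (1 - x)) = n * (-(x / (1 - x))) := by ring
    _ ≤ n * Real.log (1 - x) := mul_le_mul_of_nonneg_left hlog hn

/-- `x^n − y^n ≥ n·(x − y)·y^{n−1}` for `0 ≤ y ≤ x` (all `n` terms of the geometric sum are `≥ y^{n−1}`). [folklore] -/
theorem pow_sub_pow_ge_mul (n : ℕ) {x y : ℝ} (hy : 0 ≤ y) (hyx : y ≤ x) : n * (x - y) * y ^ (n - 1) ≤ x ^ n - y ^ n := by
  rw [← geom_sum₂_mul]
  have hsum : (n : ℝ) * y ^ (n - 1) ≤ ∑ i ∈ Finset.range n, x ^ i * y ^ (n - 1 - i) := by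
    calc (n : ℝ) * y ^ (n - 1) = ∑ i ∈ Finset.range n, y ^ (n - 1) := by rw [Finset.sum_const, Finset.card_range, nsmul_eq_mul]
      _ ≤ _ := Finset.sum_le_sum fun i hi => by
          have hi' : i ≤ n - 1 := by have := Finset.mem_range.1 hi; omega
          calc y ^ (n - 1) = y ^ i * y ^ (n - 1 - i) := by rw [← pow_add, Nat.add_sub_cancel' hi']
            _ ≤ x ^ i * y ^ (n - 1 - i) := mul_le_mul_of_nonneg_right (pow_le_pow_left₀ hy hyx i) (pow_nonneg hy _)
  have hxy : 0 ≤ x - y := sub_nonneg.2 hyx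
  calc (n : ℝ) * (x - y) * y ^ (n - 1) = (n * y ^ (n - 1)) * (x - y) := by ring
    _ ≤ _ := mul_le_mul_of_nonneg_right hsum hxy

/-- `x^n − y^n ≥ (x − y)·x^{n−1}` for `0 ≤ y ≤ x`, `1 ≤ n` (the top term of the geometric sum). [folklore] -/
theorem pow_sub_pow_ge_top {n : ℕ} (hn : 1 ≤ n) {x y : ℝ} (hy : 0 ≤ y) (hyx : y ≤ x) : (x - y) * x ^ (n - 1) ≤ x ^ n - y ^ n := by
  rw [← geom_sum₂_mul]
  have hx : 0 ≤ x := hy.trans hyx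
  have htop : x ^ (n - 1) ≤ ∑ i ∈ Finset.range n, x ^ i * y ^ (n - 1 - i) := by
    have h := Finset.single_le_sum (f := fun i => x ^ i * y ^ (n - 1 - i)) (fun i _ => by positivity) (Finset.mem_range.2 (show n - 1 < n by omega))
    simpa using h
  calc (x - y) * x ^ (n - 1) = x ^ (n - 1) * (x - y) := by ring
    _ ≤ _ := mul_le_mul_of_nonneg_right htop (sub_nonneg.2 hyx)

/-- The atom `k = 0` of the count ℓ¹ is `|(1−q)^n − (1−p)^n|`. [folklore] -/
theorem atom_zero_eq (p q : ℝ) (n : ℕ) :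
    ((n.choose 0 : ℕ) : ℝ) * |q ^ 0 * (1 - q) ^ (n - 0) - p ^ 0 * (1 - p) ^ (n - 0)| = |(1 - q) ^ n - (1 - p) ^ n| := by
  simp

/-- The atom `k = n` of the count ℓ¹ is `|q^n − p^n|`. [folklore] -/
theorem atom_top_eq (p q : ℝ) (n : ℕ) :
    ((n.choose n : ℕ) : ℝ) * |q ^ n * (1 - q) ^ (n - n) - p ^ n * (1 - p) ^ (n - n)| = |q ^ n - p ^ n| := by
  simp

/-- ★ **RARE REGIME, SAME SIDE**: `0 ≤ p ≤ q ≤ ½`, `n·q(1−q) ≤ 1` ⇒ `e^{−4}·n(q − p) ≤ ℓ` (atom `k = 0`: `(1−p)^n − (1−q)^n ≥ n(q−p)(1−q)^{n−1} ≥ n(q−p)·e^{−nq∕(1−q)}`,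
`nq∕(1−q) ≤ 4`). [folklore] -/
theorem l1Count_ge_rare_sameSide (hp0 : 0 ≤ p) (hpq : p ≤ q) (hq : q ≤ 1 / 2) {n : ℕ} (hrare : n * (q * (1 - q)) ≤ 1) :
    Real.exp (-4) * (n * (q - p)) ≤ ∑ k ∈ Finset.range (n + 1), (n.choose k : ℝ) * |q ^ k * (1 - q) ^ (n - k) - p ^ k * (1 - p) ^ (n - k)| := by
  have h1q : 1 / 2 ≤ 1 - q := by linarith
  have hn : (0 : ℝ) ≤ n := Nat.cast_nonneg n
  -- the atom k = 0
  refine le_trans ?_ (abs_atom_sub_le_l1Count p q (Nat.zero_le n))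
  rw [atom_zero_eq, abs_sub_comm, abs_of_nonneg (by nlinarith [pow_le_pow_left₀ (by linarith : 0 ≤ 1 - q) (by linarith : 1 - q ≤ 1 - p) n])]
  have hgeo := pow_sub_pow_ge_mul n (y := 1 - q) (x := 1 - p) (by linarith) (by linarith)
  -- `(1−q)^{n−1} ≥ e^{−4}`
  have hpow : Real.exp (-4) ≤ (1 - q) ^ (n - 1) := by
    have h1 : (1 - q) ^ n ≤ (1 - q) ^ (n - 1) := pow_le_pow_of_le_one (by linarith) (by linarith) (Nat.sub_le n 1)
    have h2 := exp_neg_le_one_sub_pow (x := q) (by linarith) n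
    have h3 : Real.exp (-4) ≤ Real.exp (-(n * q / (1 - q))) := by
      rw [Real.exp_le_exp, neg_le_neg_iff, div_le_iff₀ (by linarith)]
      -- `nq ≤ 4(1−q)`: `nq(1−q) ≤ 1` and `1−q ≥ ½` give `nq ≤ 2 ≤ 4(1−q)`
      have : (n : ℝ) * q * (1 - q) ≤ 1 := by linarith
      nlinarith
    linarith
  calc Real.exp (-4) * (n * (q - p)) = n * ((1 - p) - (1 - q)) * Real.exp (-4) := by ring
    _ ≤ n * ((1 - p) - (1 - q)) * (1 - q) ^ (n - 1) := mul_le_mul_of_nonneg_left hpow (by nlinarith)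
    _ ≤ _ := hgeo

/-- ★ **RARE REGIME, OPPOSITE SIDES**: `0 ≤ p ≤ ½ < q ≤ 1`, `1 ≤ n`, `n·p(1−p) ≤ 1`, `n·q(1−q) ≤ 1` ⇒ `(1∕96)·min(1, n(q−p)) ≤ ℓ` (atoms `k = 0` and `k = n`: for `n ≥ 7`
they give `≥ 2e^{−4} − 2^{1−n} ≥ e^{−4}`, for `n ≤ 6` they give `≥ (q − p)∕16 ≥ n(q−p)∕96`). [folklore] -/
theorem l1Count_ge_rare_oppositeSides (hp0 : 0 ≤ p) (hp : p ≤ 1 / 2) (hq : 1 / 2 < q) (hq1 : q ≤ 1) {n : ℕ} (hn : 1 ≤ n)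
    (hrp : n * (p * (1 - p)) ≤ 1) (hrq : n * (q * (1 - q)) ≤ 1) :
    1 / 96 * min 1 (n * (q - p)) ≤ ∑ k ∈ Finset.range (n + 1), (n.choose k : ℝ) * |q ^ k * (1 - q) ^ (n - k) - p ^ k * (1 - p) ^ (n - k)| := by
  have hpq : p ≤ q := by linarith
  have hnR : (1 : ℝ) ≤ n := by exact_mod_cast hn
  -- the two extreme atoms
  have h0n : (0 : ℕ) ≠ n := by omega
  have hpair : ((n.choose 0 : ℕ) : ℝ) * |q ^ 0 * (1 - q) ^ (n - 0) - p ^ 0 * (1 - p) ^ (n - 0)| +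
      ((n.choose n : ℕ) : ℝ) * |q ^ n * (1 - q) ^ (n - n) - p ^ n * (1 - p) ^ (n - n)| ≤
      ∑ k ∈ Finset.range (n + 1), (n.choose k : ℝ) * |q ^ k * (1 - q) ^ (n - k) - p ^ k * (1 - p) ^ (n - k)| := by
    have hs : ({0, n} : Finset ℕ) ⊆ Finset.range (n + 1) := fun k hk => by
      rcases Finset.mem_insert.1 hk with rfl | hk
      · exact Finset.mem_range.2 (by omega)
      · rw [Finset.mem_singleton.1 hk]; exact Finset.mem_range.2 (by omega)
    have h := Finset.sum_le_sum_of_subset_of_nonneg hs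
      (f := fun k => (n.choose k : ℝ) * |q ^ k * (1 - q) ^ (n - k) - p ^ k * (1 - p) ^ (n - k)|) fun k _ _ => by positivity
    rwa [Finset.sum_pair h0n] at h
  rw [atom_zero_eq, atom_top_eq, abs_sub_comm ((1 - q) ^ n),
    abs_of_nonneg (by nlinarith [pow_le_pow_left₀ (by linarith : 0 ≤ 1 - q) (by linarith : 1 - q ≤ 1 - p) n]),
    abs_of_nonneg (by nlinarith [pow_le_pow_left₀ hp0 hpq n])] at hpair
  refine le_trans ?_ hpair
  rcases le_or_gt 7 n with h7 | h7
  · -- n ≥ 7: `(1−p)^n, q^n ≥ e^{−4}`, `(1−q)^n, p^n ≤ 2^{−7}`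
    have hA : Real.exp (-4) ≤ (1 - p) ^ n := by
      refine le_trans ?_ (exp_neg_le_one_sub_pow (x := p) (by linarith) n)
      rw [Real.exp_le_exp, neg_le_neg_iff, div_le_iff₀ (by linarith)]
      have : (n : ℝ) * p * (1 - p) ≤ 1 := by linarith
      nlinarith
    have hB : Real.exp (-4) ≤ q ^ n := by
      have h := exp_neg_le_one_sub_pow (x := 1 - q) (by linarith) n
      rw [sub_sub_cancel] at h
      refine le_trans ?_ h
      rw [Real.exp_le_exp, neg_le_neg_iff, div_le_iff₀ (by linarith)]
      have : (n : ℝ) * q * (1 - q) ≤ 1 := by linarith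
      nlinarith
    have hhalf : ((1 : ℝ) / 2) ^ n ≤ 1 / 128 := by
      calc ((1 : ℝ) / 2) ^ n ≤ (1 / 2) ^ 7 := pow_le_pow_of_le_one (by norm_num) (by norm_num) h7
        _ = 1 / 128 := by norm_num
    have hC : (1 - q) ^ n ≤ 1 / 128 := (pow_le_pow_left₀ (by linarith) (by linarith : 1 - q ≤ 1 / 2) n).trans hhalf
    have hD : p ^ n ≤ 1 / 128 := (pow_le_pow_left₀ hp0 hp n).trans hhalf
    have exp_four_le : Real.exp 4 ≤ 64 := by
      rw [show (4 : ℝ) = ((4 : ℕ) : ℝ) by norm_num, ← Real.exp_one_pow]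
      nlinarith [pow_le_pow_left₀ (Real.exp_pos 1).le Real.exp_one_lt_d9.le 4]
    have hE : 1 / 64 ≤ Real.exp (-4) := by
      rw [Real.exp_neg, le_inv_comm₀ (by norm_num) (Real.exp_pos 4)]
      linarith [exp_four_le]
    have hmin : min 1 ((n : ℝ) * (q - p)) ≤ 1 := min_le_left _ _
    linarith
  · -- 1 ≤ n ≤ 6: the top terms of the geometric sums
    have hA := pow_sub_pow_ge_top hn (x := 1 - p) (y := 1 - q) (by linarith) (by linarith)
    have hB := pow_sub_pow_ge_top hn hp0 hpq
    have hhalf : (1 : ℝ) / 32 ≤ (1 / 2) ^ (n - 1) := by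
      calc (1 : ℝ) / 32 = (1 / 2) ^ 5 := by norm_num
        _ ≤ (1 / 2) ^ (n - 1) := pow_le_pow_of_le_one (by norm_num) (by norm_num) (by omega)
    have hC : (1 : ℝ) / 32 ≤ (1 - p) ^ (n - 1) := hhalf.trans (pow_le_pow_left₀ (by norm_num) (by linarith) _)
    have hD : (1 : ℝ) / 32 ≤ q ^ (n - 1) := hhalf.trans (pow_le_pow_left₀ (by norm_num) (by linarith) _)
    have hn6 : (n : ℝ) ≤ 6 := by exact_mod_cast (show n ≤ 6 by omega)
    have hmin : min 1 ((n : ℝ) * (q - p)) ≤ n * (q - p) := min_le_right _ _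
    have hqp : 0 ≤ q - p := by linarith
    nlinarith [mul_le_mul_of_nonneg_left hC hqp, mul_le_mul_of_nonneg_left hD hqp]

/-- ★★ **RARE REGIME** (`σ² = n·max(p(1−p), q(1−q)) ≤ 1`): `(1∕96)·min(1, n|q − p|) ≤ ℓ` for all `p, q ∈ [0,1]` (same side of `½`: `l1Count_ge_rare_sameSide`, reflected if both
`≥ ½`; opposite sides: `l1Count_ge_rare_oppositeSides`). [folklore] -/
theorem l1Count_ge_rare (hp0 : 0 ≤ p) (hp1 : p ≤ 1) (hq0 : 0 ≤ q) (hq1 : q ≤ 1) {n : ℕ} (hrare : n * max (p * (1 - p)) (q * (1 - q)) ≤ 1) :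
    1 / 96 * min 1 (n * |q - p|) ≤ ∑ k ∈ Finset.range (n + 1), (n.choose k : ℝ) * |q ^ k * (1 - q) ^ (n - k) - p ^ k * (1 - p) ^ (n - k)| := by
  have hn : (0 : ℝ) ≤ n := Nat.cast_nonneg n
  have hrp : (n : ℝ) * (p * (1 - p)) ≤ 1 := (mul_le_mul_of_nonneg_left (le_max_left _ _) hn).trans hrare
  have hrq : (n : ℝ) * (q * (1 - q)) ≤ 1 := (mul_le_mul_of_nonneg_left (le_max_right _ _) hn).trans hrare
  have exp_four_le : Real.exp 4 ≤ 64 := by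
    rw [show (4 : ℝ) = ((4 : ℕ) : ℝ) by norm_num, ← Real.exp_one_pow]
    nlinarith [pow_le_pow_left₀ (Real.exp_pos 1).le Real.exp_one_lt_d9.le 4]
  have hE : 1 / 96 ≤ Real.exp (-4) := by
    rw [Real.exp_neg, le_inv_comm₀ (by norm_num) (Real.exp_pos 4)]
    linarith [exp_four_le]
  wlog hpq : p ≤ q generalizing p q
  · have h := this hq0 hq1 hp0 hp1 (by rwa [max_comm]) hrq hrp (not_le.1 hpq).le
    rwa [l1Count_swap, abs_sub_comm] at h
  rcases Nat.eq_zero_or_pos n with rfl | hn1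
  · simp
  rw [abs_of_nonneg (sub_nonneg.2 hpq)]
  have hmin : min 1 ((n : ℝ) * (q - p)) ≤ n * (q - p) := min_le_right _ _
  have hΔ : 0 ≤ (n : ℝ) * (q - p) := by nlinarith
  rcases le_or_gt q (1 / 2) with hq | hq
  · -- both ≤ ½
    have h := l1Count_ge_rare_sameSide hp0 hpq hq hrq
    nlinarith
  rcases lt_or_ge p (1 / 2) with hp | hp
  · exact l1Count_ge_rare_oppositeSides hp0 hp.le hq hq1 hn1 hrp hrq
  · -- both ≥ ½: reflect
    have h := l1Count_ge_rare_sameSide (p := 1 - q) (q := 1 - p) (n := n) (by linarith) (by linarith) (by linarith)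
      (by rw [sub_sub_cancel, mul_comm (1 - p) p]; exact hrp)
    rw [l1Count_swap, l1Count_reflect] at h
    have : (1 - p) - (1 - q) = q - p := by ring
    rw [this] at h
    nlinarith
end Rare
end Summit.QuantumFields.YangMills.BalabanUVNodes.N20BlockCaricatureTVOrder

end
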